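import Literature.AlgebraicGeometry.HodgeTheory.LefschetzDecompositionPolarizationForm
import HarnessLib

/-!
# Ring 2 hypotheses, descent face — the `𝔰𝔩₂` lowering operator `ᶜΛ` of a hard Lefschetz class on
# singular cohomology (real carriers), and the relation `[L, ᶜΛ] = deg - n`

research route conditional on HC_CM; not a corollary; Q11.4-sentence-2 already refuted in dim ≥ 3.
Cell `pub-hodge-ring2` (Hodge ladder STAGE 3), seat `ring2-b05` (binder row b05
`Ring2.Hypotheses.MotivatedImpliesAlgebraicAV`), gen 34. `HC_CM` (`Theses.RankFourFaces.CMAbelianHodge`)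
does not occur in this file; nothing here proves a case of the Hodge conjecture.

Purpose. The one input of André's Prop. 2.1 (ii), first inclusion (`pr_X^*(A_motᵖ(X)) ⊆ A_motᵖ(X ⊗ Z)`,
leaf (A5) `HodgeTheory.Andre1996_motivatedClasses_pullback` of the deformation theorem `Andre1996_deformation`
= fact c24 of the cell's BINDER-OWNERS table, consumed by every row of the b05 module
`Ring2HypothesesDescentMotivatedVariational`) that the real carriers lack is the HARD LEFSCHETZ PROPERTY OF AN
EXTERIOR SUM `η₁ ⊠ 1 + 1 ⊠ η₂` on a product `X₁ ⊗ X₂` (André 1996 §1.3: "l'isomorphisme de Künneth devient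
un isomorphisme de `𝔰𝔩₂`-modules"; documented as the missing input in
`Theorems/HeckePrymWeilSummitOffWeilSectorMotivatedPullbackFstBelowMiddle`). The tree proves it for an
abstract Weil cohomology theory (`Motives/StandardConjecturesKunnethSl2Proofs`, Kleiman 1968 Thm. 2.9) by the
elementary `𝔰𝔩₂` argument; this file is step 1 of the same argument ON SINGULAR COHOMOLOGY `H•(Y; R)` of a
space `Y` with a class `κ ∈ H²(Y; R)` having the hard Lefschetz property in dimension `n` and `Hᵐ = 0` for
`m > 2n` (the setting of `HodgeTheory/LefschetzDecompositionSingular`, whose Lefschetz decomposition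
`Hⁱ = ⨁ Lᵗ Pᵃ` and primitive parts `ξ_p` we use):

* `lefschetz_span_induction` — a linear statement on `Hⁱ(Y; R)` holds once it holds on the classes
  `Lᵗ x`, `x ∈ Pᵃ` primitive, `a + t ≤ n` (Voisin I Cor. 6.26; Kleiman 1968 1.4.1);
* `exists_sl2Lowering` — **existence of Kleiman's lowering operator `ᶜΛ`** (Kleiman 1968 1.4.6; Ramón Marí
  2008 Prop. 1.1): a family `Λ a b : Hᵃ → Hᵇ`, zero unless `b + 2 = a`, with
  `Λ (Lᵗ⁺¹ x) = (t + 1)(n - a - t) · Lᵗ x` and `Λ x = 0` for `x ∈ Pᵃ` primitive — constructed as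
  `Λ y = Σ_{(a,s)} (s + 1)(n - a - s) · Lˢ ξ_{(a,s+1)}(y)` from the primitive parts;
* `sl2_lefschetz_lowering_sub` — **the `𝔰𝔩₂` relation** `L (Λ y) - Λ (L y) = (a - n) · y` on `Hᵃ`, `a ≥ 2`,
  and `sl2_lowering_lefschetz_of_le_one` (`Λ (L y) = (n - a) · y` for `a ≤ 1`), `sl2_lowering_apply_of_le_one`,
  for ANY family `Λ` with the two string formulas.

No definition, no named fact, no sorry; coefficients in any commutative ring `R`.

References: Kleiman1968AlgebraicCycles (§1.4, 1.4.1, 1.4.6), VoisinHodgeI2002 (§6.2.3 Thm. 6.25, Cor. 6.26),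
RamonMari2008LefschetzStandard (arXiv:math/0703005, Prop. 1.1), Andre1996Motifs (§1.2–1.3, pp. 11–13).
-/

noncomputable section

-- every declaration of this problem lives in `Summit.HodgeConjecture.HodgeConjecture.…` (summit = sub-problem)
set_option linter.dupNamespace false

universe u v

open Literature.AlgebraicTopology.SingularHomology Literature.Geometry.Kaehler
open Literature.AlgebraicGeometry.HodgeTheory

namespace Summit.HodgeConjecture.HodgeConjecture.Theorems

variable {Y : Type u} [TopologicalSpace Y] {R : Type v} [CommRing R]
variable {κ : singularCohomology R R Y 2} {n : ℕ}

/-! ## §1 Lefschetz span induction -/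

/-- **Lefschetz span induction** (Voisin I Cor. 6.26, Kleiman 1968 1.4.1: `Hⁱ = ⨁_{a+2t=i} Lᵗ Pᵃ`): a
property of classes of `Hⁱ(Y; R)` stable under `0` and `+` which holds for every `Lᵗ x`, `x ∈ Pᵃ`
primitive with `a + 2t = i` and `a + t ≤ n`, holds for every class — each class is the sum of the
`Lᵗ` of its primitive parts (`sum_lefschetzPowTo_primitivePart`), and the primitive parts of index
`a + t > n` vanish. [cite: VoisinHodgeI2002, §6.2.3 Cor. 6.26] [cite: Kleiman1968AlgebraicCycles, §1.4 (1.4.1)] -/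
theorem lefschetz_span_induction (hL : HasHardLefschetzProperty κ n)
    (hvan : ∀ m, 2 * n < m → Subsingleton (singularCohomology R R Y m)) {i : ℕ}
    {motive : singularCohomology R R Y i → Prop} (h0 : motive 0)
    (hadd : ∀ x y, motive x → motive y → motive (x + y))
    (hprim : ∀ (a t : ℕ) (h : a + 2 * t = i) (x : singularCohomology R R Y a),
      x ∈ primitiveClasses κ n a → a + t ≤ n → motive (lefschetzPowTo κ t a i h x))
    (x : singularCohomology R R Y i) : motive x := by
  classical
  rw [← sum_lefschetzPowTo_primitivePart hL hvan x]
  refine Finset.sum_induction _ motive hadd h0 fun p _ ↦ ?_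
  rcases le_or_gt (p.1.1 + p.1.2) n with hp | hp
  · exact hprim p.1.1 p.1.2 p.2 _ (primitivePart_mem hL hvan p x) hp
  · rw [primitivePart_of_lt hL hvan p hp, LinearMap.zero_apply, map_zero]
    exact h0

/-- Classes of degree `a ≤ 1` are primitive (`L^{n-a+1}` lands in degree `≥ 2n + 1`, where the
cohomology vanishes). [cite: VoisinHodgeI2002, §6.2.3 Def. 6.24] -/
theorem mem_primitiveClasses_of_le_one (hvan : ∀ m, 2 * n < m → Subsingleton (singularCohomology R R Y m))
    {a : ℕ} (ha : a ≤ 1) (y : singularCohomology R R Y a) :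
    y ∈ primitiveClasses κ n a := by
  refine ⟨fun hna ↦ ?_, fun r m h hr ↦ ?_⟩
  · haveI := hvan a (by omega)
    exact Subsingleton.elim _ _
  · haveI := hvan m (by omega)
    exact Subsingleton.elim _ _

/-! ## §2 Existence of the lowering operator `ᶜΛ` -/

/-- **Existence of Kleiman's lowering operator `ᶜΛ`** (Kleiman 1968, 1.4.6; Ramón Marí 2008, §1:
`ᶜΛ x = Σⱼ j (n - i + j + 1) Lʲ⁻¹ x_{i-2j}` for `x = Σⱼ Lʲ x_{i-2j}`): there is a family of `R`-linear maps
`Λ a b : Hᵃ(Y; R) → Hᵇ(Y; R)`, zero unless `b + 2 = a`, with the STRING FORMULAS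
`Λ (Lᵗ⁺¹ x) = (t + 1)(n - a - t) · Lᵗ x` and `Λ x = 0` for `x ∈ Pᵃ` primitive (for `a + t + 1 > n` both
sides of the first vanish). Construction: `Λ y = Σ_{a + 2s = b} (s + 1)(n - a - s) · Lˢ ξ_{(a, s+1)}(y)`,
`ξ_p` the primitive parts of the Lefschetz decomposition (`primitivePart`).
[cite: Kleiman1968AlgebraicCycles, §1.4 (1.4.6)] [cite: VoisinHodgeI2002, §6.2.3 Cor. 6.26] -/
theorem exists_sl2Lowering (hL : HasHardLefschetzProperty κ n)
    (hvan : ∀ m, 2 * n < m → Subsingleton (singularCohomology R R Y m)) :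
    ∃ Λ : (a b : ℕ) → singularCohomology R R Y a →ₗ[R] singularCohomology R R Y b,
      (∀ a b, b + 2 ≠ a → Λ a b = 0) ∧
      (∀ (a t i j : ℕ) (h₁ : a + 2 * (t + 1) = i) (h₂ : a + 2 * t = j) (x : singularCohomology R R Y a),
        x ∈ primitiveClasses κ n a →
          Λ i j (lefschetzPowTo κ (t + 1) a i h₁ x) =
            ((((t : ℤ) + 1) * ((n : ℤ) - a - t) : ℤ) : R) • lefschetzPowTo κ t a j h₂ x) ∧
      (∀ (a b : ℕ) (x : singularCohomology R R Y a), x ∈ primitiveClasses κ n a → Λ a b x = 0) := by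
  classical
  -- the explicit operator
  let Λ : (a b : ℕ) → singularCohomology R R Y a →ₗ[R] singularCohomology R R Y b := fun a b ↦
    if hab : b + 2 = a then
      ∑ q : {q : ℕ × ℕ // q.1 + 2 * q.2 = b},
        ((((q.1.2 : ℤ) + 1) * ((n : ℤ) - q.1.1 - q.1.2) : ℤ) : R) •
          (lefschetzPowTo κ q.1.2 q.1.1 b q.2 ∘ₗ
            primitivePart κ n hL hvan ⟨(q.1.1, q.1.2 + 1), (by omega : q.1.1 + 2 * (q.1.2 + 1) = a)⟩)
    else 0
  have hΛ : ∀ (a b : ℕ) (hab : b + 2 = a) (y : singularCohomology R R Y a),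
      Λ a b y = ∑ q : {q : ℕ × ℕ // q.1 + 2 * q.2 = b},
        ((((q.1.2 : ℤ) + 1) * ((n : ℤ) - q.1.1 - q.1.2) : ℤ) : R) •
          lefschetzPowTo κ q.1.2 q.1.1 b q.2
            (primitivePart κ n hL hvan ⟨(q.1.1, q.1.2 + 1), (by omega : q.1.1 + 2 * (q.1.2 + 1) = a)⟩ y) := by
    intro a b hab y
    simp only [Λ, dif_pos hab]
    rw [LinearMap.sum_apply]
    simp only [LinearMap.smul_apply, LinearMap.coe_comp, Function.comp_apply]
  refine ⟨Λ, fun a b hab ↦ by simp only [Λ, dif_neg hab], ?_, ?_⟩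
  · -- the string formula `Λ (Lᵗ⁺¹ x) = (t+1)(n-a-t) Lᵗ x`
    intro a t i j h₁ h₂ x hx
    have hji : j + 2 = i := by omega
    rw [hΛ i j hji]
    -- the class `Lᵗ⁺¹ x` lies in the summand of index `(a, t+1)`
    have hmem : lefschetzPowTo κ (t + 1) a i h₁ x ∈ lefschetzSummand κ n i ⟨(a, t + 1), h₁⟩ :=
      lefschetzPowTo_mem_lefschetzSummand h₁ hx
    let q₀ : {q : ℕ × ℕ // q.1 + 2 * q.2 = j} := ⟨(a, t), h₂⟩
    rw [Finset.sum_eq_single q₀]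
    · -- the term of index `(a, t)`
      change ((((t : ℤ) + 1) * ((n : ℤ) - a - t) : ℤ) : R) •
          lefschetzPowTo κ t a j h₂ (primitivePart κ n hL hvan ⟨(a, t + 1), _⟩
            (lefschetzPowTo κ (t + 1) a i h₁ x)) = _
      by_cases hle : a + (t + 1) ≤ n
      · rw [primitivePart_lefschetzPowTo_of_mem hL hvan ⟨(a, t + 1), _⟩ hle hx]
      · rw [lefschetzPowTo_eq_zero_of_mem_primitiveClasses hx h₁ (by omega), map_zero, map_zero,
          smul_zero]
        by_cases heq : a + t = n
        · have h0 : (((t : ℤ) + 1) * ((n : ℤ) - a - t) : ℤ) = 0 := by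
            have : ((n : ℤ) - a - t) = 0 := by omega
            rw [this, mul_zero]
          rw [h0, Int.cast_zero, zero_smul]
        · rw [lefschetzPowTo_eq_zero_of_mem_primitiveClasses hx h₂ (by omega), smul_zero]
    · -- the other terms vanish
      intro q _ hq
      have hne : (⟨(a, t + 1), h₁⟩ : {p : ℕ × ℕ // p.1 + 2 * p.2 = i}) ≠
          ⟨(q.1.1, q.1.2 + 1), by omega⟩ := by
        intro h
        apply hq
        have h' : (a, t + 1) = (q.1.1, q.1.2 + 1) := congrArg Subtype.val h
        obtain ⟨h1, h2⟩ := Prod.ext_iff.1 h'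
        have h3 : q.1.2 = t := by simp only at h2; omega
        exact Subtype.ext (Prod.ext h1.symm h3)
      rw [primitivePart_eq_zero_of_mem_ne hL hvan hne hmem, map_zero, smul_zero]
    · exact fun h ↦ absurd (Finset.mem_univ q₀) h
  · -- `Λ` kills primitive classes
    intro a b x hx
    by_cases hab : b + 2 = a
    · rw [hΛ a b hab]
      refine Finset.sum_eq_zero fun q _ ↦ ?_
      have hmem : x ∈ lefschetzSummand κ n a ⟨(a, 0), by omega⟩ := by
        have h := lefschetzPowTo_mem_lefschetzSummand (κ := κ) (n := n) (t := 0) (i := a)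
          (show a + 2 * 0 = a by omega) hx
        rwa [lefschetzPowTo_zero_apply] at h
      have hne : (⟨(a, 0), by omega⟩ : {p : ℕ × ℕ // p.1 + 2 * p.2 = a}) ≠
          ⟨(q.1.1, q.1.2 + 1), by omega⟩ := by
        intro h
        have h' := congrArg (fun p ↦ p.val.2) h
        simp at h'
      rw [primitivePart_eq_zero_of_mem_ne hL hvan hne hmem, map_zero, smul_zero]
    · simp only [Λ, dif_neg hab, LinearMap.zero_apply]

/-! ## §3 The `𝔰𝔩₂` relation from the string formulas -/

section Relation

variable (hL : HasHardLefschetzProperty κ n)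
    (hvan : ∀ m, 2 * n < m → Subsingleton (singularCohomology R R Y m))
  (Λ : (a b : ℕ) → singularCohomology R R Y a →ₗ[R] singularCohomology R R Y b)
  (hS : ∀ (a t i j : ℕ) (h₁ : a + 2 * (t + 1) = i) (h₂ : a + 2 * t = j) (x : singularCohomology R R Y a),
    x ∈ primitiveClasses κ n a →
      Λ i j (lefschetzPowTo κ (t + 1) a i h₁ x) =
        ((((t : ℤ) + 1) * ((n : ℤ) - a - t) : ℤ) : R) • lefschetzPowTo κ t a j h₂ x)
  (hP : ∀ (a b : ℕ) (x : singularCohomology R R Y a), x ∈ primitiveClasses κ n a → Λ a b x = 0)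

include hL hvan hS hP in
/-- **The `𝔰𝔩₂` relation** (Kleiman 1968, 1.4.6: `(ᶜΛ, L, H)` is an `𝔰𝔩₂`-triple with `H = Σ (n - a) πᵃ`;
Ramón Marí 2008, Prop. 1.1), for any family `Λ` with the two string formulas: on `Hᵃ(Y; R)` with `a ≥ 2`
(`b + 2 = a`, `a + 2 = c`), `L (Λ y) - Λ (L y) = (a - n) · y`. Checked on `Lᵗ x`, `x` primitive
(`lefschetz_span_induction`), where it is the identity `t(m - t + 1) - (t + 1)(m - t) = 2t - m`, `m = n - i`.
[cite: Kleiman1968AlgebraicCycles, §1.4 (1.4.6)] -/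
theorem sl2_lefschetz_lowering_sub {b a c : ℕ} (hba : b + 2 * 1 = a) (hac : a + 2 * 1 = c)
    (y : singularCohomology R R Y a) :
    lefschetzPowTo κ 1 b a hba (Λ a b y) - Λ c a (lefschetzPowTo κ 1 a c hac y) =
      ((((a : ℤ) - n) : ℤ) : R) • y := by
  induction y using lefschetz_span_induction hL hvan with
  | h0 => simp
  | hadd y z hy hz => rw [map_add, map_add, map_add, map_add, smul_add, ← hy, ← hz]; abel
  | hprim i t h x hx hit =>
    rcases t with _ | s
    · -- `y = L⁰ x = x` is primitive
      obtain rfl : a = i := by omega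
      have h1 := hS a 0 c a hac rfl x hx
      rw [lefschetzPowTo_zero_apply] at h1
      rw [lefschetzPowTo_zero_apply, hP _ _ x hx, map_zero, zero_sub,
        show lefschetzPowTo κ 1 a c hac x = lefschetzPowTo κ (0 + 1) a c hac x from rfl, h1, ← neg_smul]
      congr 1
      push_cast
      ring
    · -- `y = Lˢ⁺¹ x`
      have hb' : i + 2 * s = b := by omega
      have hc' : i + 2 * (s + 1 + 1) = c := by omega
      rw [hS i s a b h hb' x hx, LinearMap.map_smul,
        lefschetzPowTo_lefschetzPowTo κ 1 hb' hba h x,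
        lefschetzPowTo_lefschetzPowTo κ 1 h hac hc' x,
        hS i (s + 1) c a hc' h x hx, ← sub_smul]
      subst h
      congr 1
      push_cast
      ring

include hvan hS in
/-- The `𝔰𝔩₂` relation in the lowest degrees `a ≤ 1`, where every class is primitive:
`Λ (L y) = (n - a) · y`. [cite: Kleiman1968AlgebraicCycles, §1.4 (1.4.6)] -/
theorem sl2_lowering_lefschetz_of_le_one {a c : ℕ} (ha : a ≤ 1) (hac : a + 2 * 1 = c)
    (y : singularCohomology R R Y a) :
    Λ c a (lefschetzPowTo κ 1 a c hac y) = ((((n : ℤ) - a) : ℤ) : R) • y := by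
  have hy : y ∈ primitiveClasses κ n a := mem_primitiveClasses_of_le_one hvan ha y
  have h1 := hS a 0 c a hac rfl y hy
  rw [lefschetzPowTo_zero_apply] at h1
  rw [show lefschetzPowTo κ 1 a c hac y = lefschetzPowTo κ (0 + 1) a c hac y from rfl, h1]
  congr 1
  push_cast
  ring

include hvan hP in
/-- Every class of degree `a ≤ 1` is killed by `Λ` (it is primitive). [folklore] -/
theorem sl2_lowering_apply_of_le_one {a b : ℕ} (ha : a ≤ 1) (y : singularCohomology R R Y a) :
    Λ a b y = 0 :=
  hP a b y (mem_primitiveClasses_of_le_one hvan ha y)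

end Relation

end Summit.HodgeConjecture.HodgeConjecture.Theorems

end
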